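import Summits.PneNP.PneNP.Theorems.NegLimitedHalfWindowEngineAssembly
import Mathlib
import HarnessLib

/-!
# Route NegLimited — line `half-window`, stub `stub_halfDoorAssembly` (rung F-N1/p3, ROUND-13)

Registered stub (DA′) of the skeleton `half-window` on the rung item `NegLimited.NeglimitedHalfLogNegationsR`
(stmt-PneNP-19888; HOME/pnp-ideate-p3/r13/half-window.lean; card r13/half-window.md; BLUEPRINT-R2.md §DA′):

  `HalfDoorAssembly := GapNegationsTransfer → HalfSlicesNP → HalfEngine → NegLimited.NeglimitedHalfLogNegationsR`.

Asymptotic bookkeeping only (pattern of the door's `stub_doorAssembly`, p467364).  Given `ε > 0` put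
`ε' := min ε (1/4)`, `ε₁ := ε'/2`, `r := ⌈2/ε'⌉₊`; `L` is the NP language of (S′); given the exponent `k` and the
engine's `e` put `c := (r+24)k + (r+22)e + 1` and take `kc`, `K₃` from the engine (E′).  Along the lengths
`N = halfLen n kc r` (cofinal in `ℕ`), for all large `n`:
* the NOT budget `t = ⌊(1/2−ε)·log₂ N⌋₊` has `2^{t+1} ≤ 2·N^{1/2−ε'}` (`two_pow_negBudget_le`);
* `N ≤ 3·2^{pair r kc}·hP·n²`, `n^r ≤ 2^{r+1}·hP` and `hP ≤ 2^{20} r^{22} n^{r+22}` (`halfLen_le`,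
  `pow_le_hP`, `hP_le`; `two_pow_le_mCal`, `one_le_hP` from the EA′ file), so `2^{t+1}·hP^{-(1/2−ε₁)} ≤ C·n^{1−2ε'−rε'/2} ≤ C·n^{−2ε'} → 0` and
  `(N^k+1)·K₃·hP^e ≤ C'·n^{c−1} ≤ n^c`;
* hence a De Morgan circuit computing `halfFn n kc r` with `≤ t` NOT gates and `≤ N^k` gates would, by the
  gap transfer (T′) fed with the engine's FKG weight (imbalance and advantage both `a = K₃·hP^{-(1/2−ε₁)} ≤ 1/4`),
  give `1 ≤ (2^{t+1}−1)·22a < 1`: impossible; (S′) transports the size bound `N^k + 1` to the monotone slice of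
  `L` at length `N`.

HONEST FRAMING: assembly only; the engine (E′) and the NP plumbing (S′) are OPEN stubs of the line and are
hypotheses here; FRONTIER rung F-N1 — nothing here bears on P vs NP.
-/

set_option linter.dupNamespace false -- `Summit.PneNP.PneNP.…`: summit = sub-problem name (D-0017 single-conjunct layout)

namespace Summit.PneNP.PneNP.Theorems.NegLimitedHalfWindow

open Finset Filter
open Literature.Computability.Complexity
open Summit.PneNP.PneNP.Theorems.NegLimitedDoor (massAt agreeAt)
open Summit.PneNP.PneNP.Theorems.NegLimitedAmplifiedWindow (Edge)

/-! ### The NOT budget -/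

/-- `2^{⌊(1/2−ε)·log₂ N⌋₊ + 1} ≤ 2·N^{1/2−ε'}` for `N ≥ 1`, `0 < ε' ≤ ε`, `ε' ≤ 1/2`. -/
theorem two_pow_negBudget_le {ε ε' : ℝ} (hε'ε : ε' ≤ ε) (hε'2 : ε' ≤ 1 / 2) {N : ℕ} (hN : 1 ≤ N) :
    (2 : ℝ) ^ (⌊(1 / 2 - ε) * Real.logb 2 (N : ℝ)⌋₊ + 1) ≤ 2 * (N : ℝ) ^ (1 / 2 - ε') := by
  have hN0 : (0 : ℝ) < N := by exact_mod_cast hN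
  have hN1 : (1 : ℝ) ≤ N := by exact_mod_cast hN
  have hlog0 : 0 ≤ Real.logb 2 (N : ℝ) := Real.logb_nonneg one_lt_two hN1
  set q := (1 / 2 - ε) * Real.logb 2 (N : ℝ) with hq
  have hpow : (2 : ℝ) ^ (⌊q⌋₊ : ℝ) ≤ (N : ℝ) ^ (1 / 2 - ε') := by
    rcases le_or_gt q 0 with hq0 | hq0
    · rw [Nat.floor_of_nonpos hq0, Nat.cast_zero, Real.rpow_zero]
      exact Real.one_le_rpow hN1 (by linarith)
    · calc (2 : ℝ) ^ (⌊q⌋₊ : ℝ) ≤ (2 : ℝ) ^ q := Real.rpow_le_rpow_of_exponent_le one_le_two (Nat.floor_le hq0.le)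
        _ = (N : ℝ) ^ (1 / 2 - ε) := by
            rw [hq, mul_comm, Real.rpow_mul (by norm_num), Real.rpow_logb two_pos (by norm_num) hN0]
        _ ≤ (N : ℝ) ^ (1 / 2 - ε') := Real.rpow_le_rpow_of_exponent_le hN1 (by linarith)
  calc (2 : ℝ) ^ (⌊q⌋₊ + 1) = 2 * (2 : ℝ) ^ (⌊q⌋₊ : ℝ) := by rw [pow_succ, mul_comm, Real.rpow_natCast]
    _ ≤ 2 * (N : ℝ) ^ (1 / 2 - ε') := by linarith

/-! ### Size bookkeeping of the objects -/

/-- `mCal w ≤ w·2^w` (every term of the calibration sum is `≤ 2^w`). -/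
theorem mCal_le (w : ℕ) : mCal w ≤ w * 2 ^ w := by
  unfold mCal
  have hle : ∑ j ∈ Finset.Icc 1 w, (2 : ℚ) ^ (w - j) / (j : ℚ) ≤ ((w * 2 ^ w : ℕ) : ℚ) := by
    calc ∑ j ∈ Finset.Icc 1 w, (2 : ℚ) ^ (w - j) / (j : ℚ) ≤ ∑ j ∈ Finset.Icc 1 w, (2 : ℚ) ^ w := by
          refine Finset.sum_le_sum fun j hj => ?_
          have hj1 : (1 : ℚ) ≤ j := by exact_mod_cast (Finset.mem_Icc.1 hj).1
          calc (2 : ℚ) ^ (w - j) / (j : ℚ) ≤ (2 : ℚ) ^ (w - j) := div_le_self (by positivity) hj1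
            _ ≤ (2 : ℚ) ^ w := pow_le_pow_right₀ (by norm_num) (Nat.sub_le w j)
      _ = ((w * 2 ^ w : ℕ) : ℚ) := by
          rw [Finset.sum_const, Nat.card_Icc, nsmul_eq_mul]; push_cast; ring
  calc ⌊∑ j ∈ Finset.Icc 1 w, (2 : ℚ) ^ (w - j) / (j : ℚ)⌋₊ ≤ ⌊(((w * 2 ^ w : ℕ) : ℚ))⌋₊ := Nat.floor_le_floor hle
    _ = w * 2 ^ w := Nat.floor_natCast _

/-- Lower bound `n^r ≤ 2^{r+1}·hP n r` for `2 ≤ n` (`hP ≥ mCal w ≥ 2^{w−1}`, `2^{⌊log₂ n⌋+1} > n`). -/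
theorem pow_le_hP {n r : ℕ} (hr : 1 ≤ r) (hn : 2 ≤ n) : n ^ r ≤ 2 ^ (r + 1) * hP n r := by
  have hL : n < 2 ^ (Nat.log 2 n + 1) := Nat.lt_pow_succ_log_self (by norm_num) n
  have hw1 : 1 ≤ wOf n r := by
    unfold wOf
    have : 1 ≤ Nat.log 2 n := Nat.le_log_of_pow_le (by norm_num) (by simpa using hn)
    nlinarith
  have hm : 2 ^ (wOf n r - 1) ≤ mCal (wOf n r) := two_pow_le_mCal hw1
  have hmP : mCal (wOf n r) ≤ hP n r := by
    unfold hP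
    have h3 : 1 ≤ 3 ^ dCal (wOf n r) := Nat.one_le_pow _ _ (by norm_num)
    calc mCal (wOf n r) = mCal (wOf n r) * 1 * 1 := by ring
      _ ≤ mCal (wOf n r) * wOf n r * 3 ^ dCal (wOf n r) := Nat.mul_le_mul (Nat.mul_le_mul le_rfl hw1) h3
  have h1 : n ^ r ≤ (2 ^ (Nat.log 2 n + 1)) ^ r := Nat.pow_le_pow_left hL.le r
  have h2 : (2 ^ (Nat.log 2 n + 1)) ^ r = 2 ^ r * 2 ^ wOf n r := by
    rw [← pow_mul, wOf, show (Nat.log 2 n + 1) * r = r + r * Nat.log 2 n by ring, pow_add]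
  have h3 : 2 ^ wOf n r = 2 * 2 ^ (wOf n r - 1) := by
    rw [← pow_succ']; congr 1; omega
  calc n ^ r ≤ 2 ^ r * 2 ^ wOf n r := h2 ▸ h1
    _ = 2 ^ (r + 1) * 2 ^ (wOf n r - 1) := by rw [h3, pow_succ]; ring
    _ ≤ 2 ^ (r + 1) * hP n r := Nat.mul_le_mul_left _ (hm.trans hmP)

/-- Upper bound `hP n r ≤ 2^{20}·r^{22}·n^{r+22}` for `2 ≤ n`, `1 ≤ r` (crude: `mCal w ≤ w 2^w ≤ rn·n^r`, `w ≤ rn`,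
`3^d ≤ 4^d = 2^{20(⌊log₂ w⌋+1)} ≤ 2^{20} w^{20}`). -/
theorem hP_le {n r : ℕ} (hr : 1 ≤ r) (hn : 2 ≤ n) : hP n r ≤ 2 ^ 20 * r ^ 22 * n ^ (r + 22) := by
  have hn0 : n ≠ 0 := by omega
  set w := wOf n r with hw
  have hw1 : 1 ≤ w := by
    rw [hw]; unfold wOf
    have : 1 ≤ Nat.log 2 n := Nat.le_log_of_pow_le (by norm_num) (by simpa using hn)
    nlinarith
  have hwle : w ≤ r * n := by rw [hw]; unfold wOf; exact Nat.mul_le_mul_left _ (Nat.log_le_self 2 n)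
  have h2w : 2 ^ w ≤ n ^ r := by
    rw [hw, wOf, mul_comm, pow_mul]
    exact Nat.pow_le_pow_left (Nat.pow_log_le_self 2 hn0) r
  have hm : mCal w ≤ r * n * n ^ r := (mCal_le w).trans (Nat.mul_le_mul hwle h2w)
  have h3 : 3 ^ dCal w ≤ 2 ^ 20 * (r * n) ^ 20 := by
    unfold dCal
    have hlog : 2 ^ Nat.log 2 w ≤ w := Nat.pow_log_le_self 2 (by omega)
    calc 3 ^ (10 * (Nat.log 2 w + 1)) ≤ 4 ^ (10 * (Nat.log 2 w + 1)) := Nat.pow_le_pow_left (by norm_num) _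
      _ = 2 ^ 20 * (2 ^ Nat.log 2 w) ^ 20 := by
          rw [show (4 : ℕ) = 2 ^ 2 by norm_num, ← pow_mul, ← pow_mul]
          rw [show 2 * (10 * (Nat.log 2 w + 1)) = 20 + Nat.log 2 w * 20 by ring, pow_add]
      _ ≤ 2 ^ 20 * (r * n) ^ 20 := Nat.mul_le_mul_left _ (Nat.pow_le_pow_left (hlog.trans hwle) 20)
  unfold hP
  rw [← hw]
  calc mCal w * w * 3 ^ dCal w ≤ (r * n * n ^ r) * (r * n) * (2 ^ 20 * (r * n) ^ 20) :=
        Nat.mul_le_mul (Nat.mul_le_mul hm hwle) h3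
    _ = 2 ^ 20 * r ^ 22 * n ^ (r + 22) := by ring

/-- `halfLen n kc r ≤ 3·2^{pair r kc}·(hP·n²)` once `hP·n² ≥ 1`. -/
theorem halfLen_le {n kc r : ℕ} (h1 : 1 ≤ hP n r * n ^ 2) :
    halfLen n kc r ≤ 3 * 2 ^ Nat.pair r kc * (hP n r * n ^ 2) := by
  unfold halfLen
  nlinarith [Nat.one_le_two_pow (n := Nat.pair r kc)]

/-- `n ≤ halfLen n kc r` for `2 ≤ n`, `1 ≤ r`. -/
theorem le_halfLen {n kc r : ℕ} (hr : 1 ≤ r) (hn : 2 ≤ n) : n ≤ halfLen n kc r := by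
  unfold halfLen
  have h1 := one_le_hP (r := r) hr hn
  have h2 : 1 ≤ 2 ^ Nat.pair r kc := Nat.one_le_two_pow
  have h3 : n ≤ n ^ 2 := by nlinarith
  have h4 : n ≤ 2 * (hP n r * n ^ 2) + 1 := by nlinarith
  calc n ≤ 1 * (2 * (hP n r * n ^ 2) + 1) := by rw [one_mul]; exact h4
    _ ≤ 2 ^ Nat.pair r kc * (2 * (hP n r * n ^ 2) + 1) := Nat.mul_le_mul_right _ h2

/-- The size facts at one `n`, cast to `ℝ`. -/
theorem numeric_facts {n kc r : ℕ} (hr : 1 ≤ r) (hn : 2 ≤ n) :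
    (1 : ℝ) ≤ (hP n r : ℝ) ∧ 1 ≤ halfLen n kc r ∧
      ((halfLen n kc r : ℕ) : ℝ) ≤ 3 * (2 : ℝ) ^ Nat.pair r kc * (hP n r : ℝ) * (n : ℝ) ^ 2 ∧
      (n : ℝ) ^ r ≤ (2 : ℝ) ^ (r + 1) * (hP n r : ℝ) ∧
      (hP n r : ℝ) ≤ (2 : ℝ) ^ 20 * (r : ℝ) ^ 22 * (n : ℝ) ^ (r + 22) := by
  have h1 := one_le_hP hr hn
  have hsq : 1 ≤ hP n r * n ^ 2 := by
    have := Nat.mul_le_mul h1 (Nat.one_le_pow 2 n (by omega))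
    simpa using this
  refine ⟨by exact_mod_cast h1, (show 1 ≤ n by omega).trans (le_halfLen hr hn), ?_, ?_, ?_⟩
  · have h := halfLen_le (kc := kc) hsq
    have h' : ((halfLen n kc r : ℕ) : ℝ) ≤ ((3 * 2 ^ Nat.pair r kc * (hP n r * n ^ 2) : ℕ) : ℝ) := by
      exact_mod_cast h
    have e : ((3 * 2 ^ Nat.pair r kc * (hP n r * n ^ 2) : ℕ) : ℝ) =
        3 * (2 : ℝ) ^ Nat.pair r kc * (hP n r : ℝ) * (n : ℝ) ^ 2 := by push_cast; ring
    linarith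
  · exact_mod_cast pow_le_hP hr hn
  · exact_mod_cast hP_le hr hn

/-! ### The real-analysis step -/

/-- The exponent bookkeeping: with `N ≤ P·H·n²`, `n^r ≤ R·H`, `H ≥ 1`, `n ≥ 1`, `r ε' ≥ 2`, `0 < ε' ≤ 1/2`:
`N^{1/2−ε'} · H^{-(1/2−ε'/2)} ≤ P^{1/2−ε'}·R^{ε'/2}·n^{−2ε'}`. -/
theorem budget_rpow_le {N H n P R : ℝ} {r : ℕ} {ε' : ℝ} (hε' : 0 < ε') (hε'2 : ε' ≤ 1 / 2)
    (hr : 2 ≤ r * ε') (hn : 1 ≤ n) (hH : 1 ≤ H) (hP : 0 < P) (hR : 0 < R) (hN0 : 0 ≤ N)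
    (hNle : N ≤ P * H * n ^ 2) (hnH : n ^ r ≤ R * H) :
    N ^ (1 / 2 - ε') * H ^ (-(1 / 2 - ε' / 2)) ≤ P ^ (1 / 2 - ε') * R ^ (ε' / 2) * n ^ (-(2 * ε')) := by
  have hn0 : 0 < n := by linarith
  have hH0 : 0 < H := by linarith
  have hexp : 0 ≤ 1 / 2 - ε' := by linarith
  -- `N^{1/2−ε'} ≤ P^{1/2−ε'} H^{1/2−ε'} n^{1−2ε'}`
  have h1 : N ^ (1 / 2 - ε') ≤ P ^ (1 / 2 - ε') * H ^ (1 / 2 - ε') * n ^ (1 - 2 * ε') := by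
    calc N ^ (1 / 2 - ε') ≤ (P * H * n ^ 2) ^ (1 / 2 - ε') := Real.rpow_le_rpow hN0 hNle hexp
      _ = P ^ (1 / 2 - ε') * H ^ (1 / 2 - ε') * (n ^ 2) ^ (1 / 2 - ε') := by
          rw [Real.mul_rpow (by positivity) (by positivity), Real.mul_rpow hP.le hH0.le]
      _ = P ^ (1 / 2 - ε') * H ^ (1 / 2 - ε') * n ^ (1 - 2 * ε') := by
          congr 1
          rw [show (n ^ 2 : ℝ) = n ^ ((2 : ℕ) : ℝ) by rw [Real.rpow_natCast], ← Real.rpow_mul hn0.le]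
          congr 1; push_cast; ring
  -- `H^{-ε'/2} ≤ R^{ε'/2} n^{−rε'/2} ≤ R^{ε'/2} n^{-1}`
  have h2 : H ^ (-(ε' / 2)) ≤ R ^ (ε' / 2) * n ^ (-(r * ε' / 2)) := by
    have hq : n ^ r / R ≤ H := by rw [div_le_iff₀ hR]; linarith
    have hq0 : 0 < n ^ r / R := by positivity
    calc H ^ (-(ε' / 2)) ≤ (n ^ r / R) ^ (-(ε' / 2)) := Real.rpow_le_rpow_of_nonpos hq0 hq (by linarith)
      _ = R ^ (ε' / 2) * n ^ (-(r * ε' / 2)) := by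
          rw [Real.div_rpow (by positivity) hR.le, Real.rpow_neg hR.le, div_inv_eq_mul, mul_comm]
          congr 1
          rw [show (n ^ r : ℝ) = n ^ ((r : ℕ) : ℝ) by rw [Real.rpow_natCast], ← Real.rpow_mul hn0.le]
          congr 1; ring
  have h3 : n ^ (-(r * ε' / 2)) ≤ n ^ (-(1 : ℝ)) := Real.rpow_le_rpow_of_exponent_le hn (by linarith)
  -- combine
  have hsplit : H ^ (-(1 / 2 - ε' / 2)) = H ^ (-(1 / 2 - ε')) * H ^ (-(ε' / 2)) := by
    rw [← Real.rpow_add hH0]; congr 1; ring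
  have hcancel : H ^ (1 / 2 - ε') * H ^ (-(1 / 2 - ε')) = 1 := by
    rw [Real.rpow_neg hH0.le, mul_inv_cancel₀ (Real.rpow_pos_of_pos hH0 _).ne']
  have hnn : n ^ (1 - 2 * ε') * n ^ (-(1 : ℝ)) = n ^ (-(2 * ε')) := by
    rw [← Real.rpow_add hn0]; congr 1; ring
  have hA : 0 ≤ P ^ (1 / 2 - ε') := Real.rpow_nonneg hP.le _
  have hB : 0 ≤ R ^ (ε' / 2) := Real.rpow_nonneg hR.le _
  have hC : 0 ≤ n ^ (1 - 2 * ε') := Real.rpow_nonneg hn0.le _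
  have hD : 0 ≤ H ^ (-(1 / 2 - ε')) := Real.rpow_nonneg hH0.le _
  have hE : 0 ≤ H ^ (-(ε' / 2)) := Real.rpow_nonneg hH0.le _
  calc N ^ (1 / 2 - ε') * H ^ (-(1 / 2 - ε' / 2))
      = N ^ (1 / 2 - ε') * H ^ (-(1 / 2 - ε')) * H ^ (-(ε' / 2)) := by rw [hsplit, mul_assoc]
    _ ≤ (P ^ (1 / 2 - ε') * H ^ (1 / 2 - ε') * n ^ (1 - 2 * ε')) * H ^ (-(1 / 2 - ε')) *
          (R ^ (ε' / 2) * n ^ (-(1 : ℝ))) :=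
        mul_le_mul (mul_le_mul_of_nonneg_right h1 hD) (h2.trans (mul_le_mul_of_nonneg_left h3 hB)) hE
          (mul_nonneg (mul_nonneg (mul_nonneg hA (Real.rpow_nonneg hH0.le _)) hC) hD)
    _ = P ^ (1 / 2 - ε') * R ^ (ε' / 2) * (H ^ (1 / 2 - ε') * H ^ (-(1 / 2 - ε'))) *
          (n ^ (1 - 2 * ε') * n ^ (-(1 : ℝ))) := by ring
    _ = P ^ (1 / 2 - ε') * R ^ (ε' / 2) * n ^ (-(2 * ε')) := by rw [hcancel, hnn, mul_one]

/-- Eventually `C·n^{−2ε'} < δ` (for `ε' > 0`, `δ > 0`). -/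
theorem eventually_const_mul_rpow_neg_lt {ε' C δ : ℝ} (hε' : 0 < ε') (hδ : 0 < δ) :
    ∀ᶠ n : ℕ in atTop, C * (n : ℝ) ^ (-(2 * ε')) < δ := by
  have ht : Tendsto (fun n : ℕ => (n : ℝ) ^ (-(2 * ε'))) atTop (nhds 0) :=
    (tendsto_rpow_neg_atTop (by positivity)).comp tendsto_natCast_atTop_atTop
  have ht' : Tendsto (fun n : ℕ => C * (n : ℝ) ^ (-(2 * ε'))) atTop (nhds (C * 0)) := ht.const_mul C
  rw [mul_zero] at ht'
  exact ht'.eventually (gt_mem_nhds hδ)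

/-! ### The stub -/

set_option maxHeartbeats 400000 in
/-- **Registered stub `stub_halfDoorAssembly`** of the skeleton `half-window` (stmt-PneNP-19888): gap transfer
(T′) + slices (S′) + the engine (E′) ⟹ the rung `NegLimited.NeglimitedHalfLogNegationsR`, along the lengths
`N = halfLen n kc r` with `ε' = min ε (1/4)`, `ε₁ = ε'/2`, `r = ⌈2/ε'⌉₊`, `c = (r+24)k + (r+22)e + 1`. -/
theorem stub_halfDoorAssembly : HalfDoorAssembly := by
  intro hT hS hE ε hε
  obtain ⟨L, hLNP, hL⟩ := hS
  obtain ⟨e, hEe⟩ := hE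
  refine ⟨L, hLNP, fun k => ?_⟩
  -- parameters
  obtain ⟨ε', hε'⟩ : ∃ ε' : ℝ, ε' = min ε (1 / 4) := ⟨_, rfl⟩
  have hε'0 : 0 < ε' := by rw [hε']; exact lt_min hε (by norm_num)
  have hε'ε : ε' ≤ ε := by rw [hε']; exact min_le_left _ _
  have hε'4 : ε' ≤ 1 / 4 := by rw [hε']; exact min_le_right _ _
  obtain ⟨r, hr⟩ : ∃ r : ℕ, r = ⌈2 / ε'⌉₊ := ⟨_, rfl⟩
  have hrε : 2 ≤ (r : ℝ) * ε' := by
    have h := Nat.le_ceil (2 / ε')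
    rw [← hr] at h
    have : 2 / ε' * ε' = 2 := div_mul_cancel₀ _ hε'0.ne'
    nlinarith
  have hr1 : 1 ≤ r := by
    have : (1 : ℝ) ≤ r := by nlinarith
    exact_mod_cast this
  obtain ⟨c, hc⟩ : ∃ c : ℕ, c = (r + 24) * k + (r + 22) * e + 1 := ⟨_, rfl⟩
  obtain ⟨kc, hkc3, K₃, hK₃, hev⟩ := hEe (ε' / 2) (by positivity) r c hr1
  -- constants
  obtain ⟨P, hPdef⟩ : ∃ P : ℝ, P = 3 * (2 : ℝ) ^ Nat.pair r kc := ⟨_, rfl⟩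
  obtain ⟨R, hRdef⟩ : ∃ R : ℝ, R = (2 : ℝ) ^ (r + 1) := ⟨_, rfl⟩
  obtain ⟨Q, hQdef⟩ : ∃ Q : ℝ, Q = (2 : ℝ) ^ 20 * (r : ℝ) ^ 22 := ⟨_, rfl⟩
  have hP0 : 0 < P := by rw [hPdef]; positivity
  have hR0 : 0 < R := by rw [hRdef]; positivity
  have hQ0 : 0 < Q := by rw [hQdef]; positivity
  obtain ⟨Cst, hCst⟩ : ∃ Cst : ℝ, Cst = 44 * K₃ * (P ^ (1 / 2 - ε') * R ^ (ε' / 2)) := ⟨_, rfl⟩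
  obtain ⟨Cst', hCst'⟩ : ∃ Cst' : ℝ, Cst' = 2 * (P * Q) ^ k * K₃ * Q ^ e := ⟨_, rfl⟩
  -- everything happens eventually in `n`, at the length `N = halfLen n kc r`
  have hmain : ∀ᶠ n : ℕ in atTop, Monotone (L.sliceFn (halfLen n kc r)) ∧
      (halfLen n kc r) ^ k < negLimitedSizeOver deMorganBasis
        ⌊(1 / 2 - ε) * Real.logb 2 ((halfLen n kc r : ℕ) : ℝ)⌋₊ (L.sliceFn (halfLen n kc r)) := by
    filter_upwards [hev, eventually_gt_atTop kc, eventually_ge_atTop 2,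
      eventually_const_mul_rpow_neg_lt (C := Cst) hε'0 one_pos,
      tendsto_natCast_atTop_atTop.eventually_ge_atTop Cst'] with n hEn hkn hn2 hsmall hbig
    obtain ⟨hFmono, ν, hν0, hνfkg, hν1, himb, hhard⟩ := hEn
    obtain ⟨hmono, htransfer⟩ := hL n kc r hkc3 hkn hr1
    refine ⟨hmono, ?_⟩
    obtain ⟨N, hNdef⟩ : ∃ N : ℕ, N = halfLen n kc r := ⟨_, rfl⟩
    obtain ⟨t, htdef⟩ : ∃ t : ℕ, t = ⌊(1 / 2 - ε) * Real.logb 2 ((halfLen n kc r : ℕ) : ℝ)⌋₊ := ⟨_, rfl⟩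
    rw [← htdef]
    obtain ⟨a, hadef⟩ : ∃ a : ℝ, a = K₃ * (hP n r : ℝ) ^ (-(1 / 2 - ε' / 2)) := ⟨_, rfl⟩
    -- numeric facts at this `n`
    have hn1 : 1 ≤ n := by omega
    have hnR : (1 : ℝ) ≤ n := by exact_mod_cast hn1
    have hnR0 : (0 : ℝ) < n := by linarith
    obtain ⟨hH1, hN1', hNle', hnH', hHle'⟩ := numeric_facts (kc := kc) hr1 hn2
    have hH0 : (0 : ℝ) < hP n r := by linarith
    have hN1 : 1 ≤ N := by rw [hNdef]; exact hN1'
    have hNR1 : (1 : ℝ) ≤ (N : ℝ) := by exact_mod_cast hN1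
    have hNle : (N : ℝ) ≤ P * (hP n r : ℝ) * (n : ℝ) ^ 2 := by rw [hPdef, hNdef]; exact hNle'
    have hnH : (n : ℝ) ^ r ≤ R * (hP n r : ℝ) := by rw [hRdef]; exact hnH'
    have hHle : (hP n r : ℝ) ≤ Q * (n : ℝ) ^ (r + 22) := by rw [hQdef]; exact hHle'
    have ha0 : 0 ≤ a := by rw [hadef]; exact mul_nonneg hK₃.le (Real.rpow_nonneg hH0.le _)
    -- the key inequality `(2^{t+1} − 1)·22a < 1`
    have hkey : ((2 : ℝ) ^ (t + 1) - 1) * (22 * a) < 1 := by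
      have hbud : (2 : ℝ) ^ (t + 1) ≤ 2 * (N : ℝ) ^ (1 / 2 - ε') := by
        rw [htdef, hNdef]; exact two_pow_negBudget_le hε'ε (by linarith) (hNdef ▸ hN1)
      have hrp := budget_rpow_le hε'0 (by linarith) hrε hnR hH1 hP0 hR0 (by positivity) hNle hnH
      have hx0 : 0 ≤ (hP n r : ℝ) ^ (-(1 / 2 - ε' / 2)) := Real.rpow_nonneg hH0.le _
      calc ((2 : ℝ) ^ (t + 1) - 1) * (22 * a) ≤ (2 * (N : ℝ) ^ (1 / 2 - ε')) * (22 * a) :=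
            mul_le_mul_of_nonneg_right (by linarith) (by positivity)
        _ = 44 * K₃ * ((N : ℝ) ^ (1 / 2 - ε') * (hP n r : ℝ) ^ (-(1 / 2 - ε' / 2))) := by
            rw [hadef]; ring
        _ ≤ 44 * K₃ * (P ^ (1 / 2 - ε') * R ^ (ε' / 2) * (n : ℝ) ^ (-(2 * ε'))) :=
            mul_le_mul_of_nonneg_left hrp (by positivity)
        _ = Cst * (n : ℝ) ^ (-(2 * ε')) := by rw [hCst]; ring
        _ < 1 := hsmall
    have ha4 : a ≤ 1 / 4 := by
      have h2 : (2 : ℝ) ≤ (2 : ℝ) ^ (t + 1) := by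
        calc (2 : ℝ) = 2 ^ 1 := by norm_num
          _ ≤ 2 ^ (t + 1) := pow_le_pow_right₀ (by norm_num) (by omega)
      have h22 : 22 * a ≤ ((2 : ℝ) ^ (t + 1) - 1) * (22 * a) :=
        le_mul_of_one_le_left (by linarith) (by linarith)
      linarith
    -- the size budget `(N^k + 1)·K₃·hP^e ≤ n^c`
    have hsizebud : (((N ^ k : ℕ) : ℝ) + 1) * K₃ * (hP n r : ℝ) ^ e ≤ (n : ℝ) ^ c := by
      have hNk : ((N ^ k : ℕ) : ℝ) ≤ (P * Q) ^ k * (n : ℝ) ^ ((r + 24) * k) := by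
        push_cast
        calc (N : ℝ) ^ k ≤ (P * Q * (n : ℝ) ^ (r + 24)) ^ k := by
              refine pow_le_pow_left₀ (by positivity) ?_ k
              calc (N : ℝ) ≤ P * (hP n r : ℝ) * (n : ℝ) ^ 2 := hNle
                _ ≤ P * (Q * (n : ℝ) ^ (r + 22)) * (n : ℝ) ^ 2 :=
                    mul_le_mul_of_nonneg_right (mul_le_mul_of_nonneg_left hHle hP0.le) (by positivity)
                _ = P * Q * (n : ℝ) ^ (r + 24) := by ring
          _ = (P * Q) ^ k * (n : ℝ) ^ ((r + 24) * k) := by rw [mul_pow, ← pow_mul]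
      have hNk1 : ((N ^ k : ℕ) : ℝ) + 1 ≤ 2 * ((P * Q) ^ k * (n : ℝ) ^ ((r + 24) * k)) := by
        have h1 : (1 : ℝ) ≤ (P * Q) ^ k * (n : ℝ) ^ ((r + 24) * k) := by
          have hP1 : (1 : ℝ) ≤ P := by
            rw [hPdef]
            have h2p : (1 : ℝ) ≤ (2 : ℝ) ^ Nat.pair r kc := one_le_pow₀ (by norm_num)
            linarith
          have hQ1 : (1 : ℝ) ≤ Q := by
            rw [hQdef]
            exact one_le_mul_of_one_le_of_one_le (one_le_pow₀ (by norm_num))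
              (one_le_pow₀ (by exact_mod_cast hr1))
          have hPQ1 : (1 : ℝ) ≤ P * Q := one_le_mul_of_one_le_of_one_le hP1 hQ1
          exact one_le_mul_of_one_le_of_one_le (one_le_pow₀ hPQ1) (one_le_pow₀ hnR)
        linarith
      have hHe : (hP n r : ℝ) ^ e ≤ Q ^ e * (n : ℝ) ^ ((r + 22) * e) := by
        calc (hP n r : ℝ) ^ e ≤ (Q * (n : ℝ) ^ (r + 22)) ^ e := pow_le_pow_left₀ hH0.le hHle e
          _ = Q ^ e * (n : ℝ) ^ ((r + 22) * e) := by rw [mul_pow, ← pow_mul]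
      calc (((N ^ k : ℕ) : ℝ) + 1) * K₃ * (hP n r : ℝ) ^ e
          ≤ (2 * ((P * Q) ^ k * (n : ℝ) ^ ((r + 24) * k))) * K₃ * (Q ^ e * (n : ℝ) ^ ((r + 22) * e)) :=
            mul_le_mul (mul_le_mul_of_nonneg_right hNk1 hK₃.le) hHe (pow_nonneg hH0.le e)
              (mul_nonneg (mul_nonneg (by norm_num) (mul_nonneg (pow_nonneg (mul_nonneg hP0.le hQ0.le) k)
                (pow_nonneg hnR0.le _))) hK₃.le)
        _ = Cst' * (n : ℝ) ^ ((r + 24) * k + (r + 22) * e) := by rw [hCst', pow_add]; ring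
        _ ≤ (n : ℝ) * (n : ℝ) ^ ((r + 24) * k + (r + 22) * e) :=
            mul_le_mul_of_nonneg_right hbig (by positivity)
        _ = (n : ℝ) ^ c := by rw [hc, pow_succ]; ring
    -- every De Morgan circuit with `≤ t` NOTs computing `halfFn` is large
    have hbigD : ∀ D : Circuit (HBlk n r × Edge n), D.IsOver deMorganBasis →
        D.Computes (halfFn n kc r) → D.negationCount ≤ t → N ^ k + 1 ≤ D.size := by
      intro D hD hcomp hneg
      by_contra hlt
      have hsize : D.size ≤ N ^ k := by omega
      have h1 : (1 : ℝ) ≤ ((2 : ℝ) ^ (t + 1) - 1) * (6 * a + 16 * a) := by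
        refine hT (HBlk n r × Edge n) ν hν0 hνfkg hν1 (halfFn n kc r) hFmono a a ha0 ha0 ha4
          (by rw [hadef]; exact himb) D t hD hcomp hneg ?_
        intro M hM hMs
        have hM01 : M.IsOver monotoneBasis01 := hM.mono monotoneBasis_subset_monotoneBasis01
        rw [hadef]
        refine hhard M hM01 ?_
        have hMsz : (M.size : ℝ) ≤ ((N ^ k : ℕ) : ℝ) := by exact_mod_cast hMs.trans hsize
        calc ((M.size : ℝ) + 1) * K₃ * (hP n r : ℝ) ^ e
            ≤ (((N ^ k : ℕ) : ℝ) + 1) * K₃ * (hP n r : ℝ) ^ e :=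
              mul_le_mul_of_nonneg_right (mul_le_mul_of_nonneg_right (by linarith) hK₃.le)
                (pow_nonneg hH0.le e)
          _ ≤ (n : ℝ) ^ c := hsizebud
      have h2 : ((2 : ℝ) ^ (t + 1) - 1) * (6 * a + 16 * a) = ((2 : ℝ) ^ (t + 1) - 1) * (22 * a) := by ring
      rw [h2] at h1
      linarith
    have hfin := htransfer t (N ^ k + 1) hbigD
    rw [hNdef] at hfin
    exact hfin
  -- the lengths `halfLen n kc r ≥ n` are cofinal: `∃ᶠ N`
  rw [Filter.frequently_atTop]
  intro a
  obtain ⟨n₀, hn₀⟩ := Filter.eventually_atTop.1 (hmain.and (eventually_ge_atTop 2))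
  obtain ⟨h1, h2⟩ := hn₀ (max a n₀) (le_max_right _ _)
  exact ⟨halfLen (max a n₀) kc r, (le_max_left a n₀).trans (le_halfLen hr1 h2), h1⟩
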